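import Summits.ValiantsHypothesis.ValiantsHypothesis.Theorems.GeneratorObstructionsPerGenDegreeSuperQPMinimalDegree
import Summits.ValiantsHypothesis.ValiantsHypothesis.Theorems.GeneratorObstructionsPerGenDegreeSuperQPRectangularRays
import Literature.Computability.AlgebraicComplexity.SLOrbitClosureInvariantSeparation
import Literature.Computability.AlgebraicComplexity.OrbitClosureProofs

/-!
# Route GeneratorObstructions — K1 `PerGenDegreeSuperQP` (stmt-ValiantsHypothesis-11654),
# line `per-side-atoms`: the RAY CRITERION — rectangular occurrence is semistability of
# few-variable degenerations; `stub_atomLate` ⇐ nullcone-inseparability in quasi-polynomial degree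

Eighth support file of the line (companions `…AtomCertificates`, `…RectangularAtom`,
`…AtomsGenerate`, `…MinimalDegree`, `…RectangularRays`, `…DimensionGap`, `…ExtremalRays`).

`…RectangularRays` reduced the registered `stub_atomLate` to a LATE START of the occurrence monoid
`S(per_m)` on some rectangular ray `ℝ₊(1^j)^*`, `j ≤ m²` (`stub_atomLate_of_late_rectangle`), and
recorded that for `m < j < m²` no first-occurrence degree is known in print. This file identifies
what those degrees ARE, for an arbitrary form `f` of degree `n ≥ 1` on finitely many linearly
ordered variables `τ ≃o Fin N` and then for `per_m`:

**Ray criterion.** Call a form `q` in `j` variables a *`j`-variable degeneration* of `f` if,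
placed on the `j` greatest variables, it lies in the orbit closure `Δ(f)` (equivalently — and this
is how the witnesses arise — `q` is the part in the `j` greatest variables of a translate `A·f`,
`A ∈ GL_τ`, all other variables killed: `exists_projection_of_hasHighestWeight_rectangle`). Then

* `(k^j)^* ∈ S(f)` **iff** some `j`-variable degeneration `q` of `f` carries a homogeneous
  `SL_j`-invariant of degree `d = jk/n` NOT vanishing at `q`, i.e. `d ∈ E(q)`, BI 2017's degree
  monoid (`hasHighestWeight_rectangle_of_projection` ⇐, any injective placement;
  `exists_projection_of_hasHighestWeight_rectangle` ⇒);
* in particular the ray `j` is HIT iff some `j`-variable degeneration of `f` is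
  `SL_j`-SEMISTABLE (`exists_hasHighestWeight_rectangle_of_isSLSemistable_projection`,
  `exists_isSLSemistable_projection_of_hasHighestWeight_rectangle`), and the first-occurrence
  degree on the ray is the least positive element of `⋃_q E(q)` over the `j`-variable
  degenerations `q` — the least degree of an `SL_j`-invariant of `j`-ary `n`-ics not vanishing
  identically on the variety of `j`-variable degenerations of `f`.

For `j = N` this is the fundamental-invariant ray of `…MinimalDegree` (`q = f`, degree `e(f)`);
for `j ≤ m` and `f = per_m` the degenerations include the Chow form `y₁⋯y_m` and all its
specialisations (every binary `m`-ic, for `j = 2`), which is why those rays start early.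

**Consequence for the stub** (`stub_atomLate_of_nullcone_inseparable`): `stub_atomLate` holds
verbatim as soon as, for every `c` and infinitely many `m`, some `j ≤ m²` has an
`SL_j`-semistable `j`-variable degeneration of `per_m` while NO `SL_j`-invariant of degree
`≤ 2^((log₂ m + c)^c)` is nonzero at ANY `j`-variable degeneration of `per_m` — "the
`j`-variable degenerations of the permanent are semistable but cannot be separated from the
nullcone in quasi-polynomial degree". This is the invariant-theoretic content of a late
rectangular atom; it is the statement a disprover has to test at `m = 3`, `j = 4, …, 8`
(e.g. `j = 4`: every cubic surface `ℓ₁ℓ₂ℓ₃ + m₁m₂m₃ = per₃ [[ℓ₁,m₁,0],[0,ℓ₂,m₂],[m₃,0,ℓ₃]]` is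
a 4-variable degeneration of `per₃`, the generic one is smooth hence stable, and the least
degree of an invariant of cubic surfaces is `8 < 9 = m²`: ray `4` of `S(per₃)` starts at the
atom `(6,6,6,6)^*` of degree `8` — early).

Honest framing: structure theorems and a conditional reduction; `stub_atomLate` (`c ≥ 2`), K1
and `GenFlipThesis` remain OPEN; nothing here bears on VP versus VNP.
References: [BurgisserIkenmeyer2017] Def. 3.3, Lemma 3.2, Rem. 3.13 (degree monoid, invariants
as highest-weight vectors of constant weight); [BurgisserEtAl2011] Prop. 6.3.2 (inheritance,
tree `OrbitClosureInheritance`); [MumfordFogartyKirwan1994] Ch. 2 §1 Prop. 2.2 (semistable =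
some invariant does not vanish, tree `isSLSemistable_iff_exists_isSLInvariantCoord`).
-/

set_option linter.dupNamespace false

noncomputable section

namespace Summit.ValiantsHypothesis.ValiantsHypothesis.Theorems.GeneratorObstructions.PerGenDegreeSuperQP

open MvPolynomial
open Literature.NumberTheory.DiophantineGeometry Literature.Computability.AlgebraicComplexity
  Literature.Computability.Complexity
open Literature.Barriers.ValiantsHypothesis (degIdxMap killCompl_X_app killCompl_X_of_not_mem)

/-! ### 1. Killing variables is a linear endomorphism: parts of translates are degenerations -/

section Kill

variable {σ τ : Type*} [Fintype σ] [Fintype τ] [DecidableEq τ] {ι : σ → τ}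

/-- Killing the variables off `range ι` and renaming back is the linear substitution by the
diagonal `0/1` projection onto the `ι`-variables. [folklore] -/
theorem exists_rename_killCompl_eq_linSubst (hι : Function.Injective ι) :
    ∃ P : Matrix τ τ ℂ, ∀ Q : MvPolynomial τ ℂ,
      rename ι (killCompl hι Q) = linSubst τ ℂ P Q := by
  classical
  refine ⟨Matrix.of fun y x => if y = x ∧ x ∈ Set.range ι then 1 else 0, fun Q => ?_⟩
  suffices h : (rename ι).comp (killCompl hι) =
      linSubst τ ℂ (Matrix.of fun y x => if y = x ∧ x ∈ Set.range ι then (1 : ℂ) else 0) from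
    congrArg (fun φ => φ Q) h
  apply MvPolynomial.algHom_ext
  intro x
  rw [AlgHom.comp_apply, linSubst_X]
  by_cases hx : x ∈ Set.range ι
  · obtain ⟨i, rfl⟩ := hx
    rw [killCompl_X_app, rename_X]
    simp only [Matrix.of_apply]
    rw [Finset.sum_eq_single (ι i)]
    · simp
    · intro y _ hy
      rw [if_neg (fun h => hy h.1), zero_smul]
    · intro h; exact absurd (Finset.mem_univ _) h
  · rw [killCompl_X_of_not_mem hι hx, map_zero]
    symm
    refine Finset.sum_eq_zero fun y _ => ?_
    simp only [Matrix.of_apply]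
    rw [if_neg (fun h => hx h.2), zero_smul]

/-- **Parts of translates are degenerations.** For any matrix `A` and any injective placement
`ι`, the part of `A·f` in the `ι`-variables (all other variables killed), placed back on the
`ι`-variables, lies in the orbit closure `Δ(f)`: it is `(P A)·f` for the `0/1` projection `P`,
a point of the endomorphism orbit (`endOrbit_subset_orbitClosure`). [cite: MulmuleySohoni2001, §4] -/
theorem rename_killCompl_linSubst_mem_orbitClosure (hι : Function.Injective ι)
    (f : MvPolynomial τ ℂ) (A : Matrix τ τ ℂ) :
    rename ι (killCompl hι (linSubst τ ℂ A f)) ∈ orbitClosure f := by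
  haveI : Infinite ℂ := CharZero.infinite ℂ
  obtain ⟨P, hP⟩ := exists_rename_killCompl_eq_linSubst (ι := ι) hι
  rw [hP, ← AlgHom.comp_apply, ← linSubst_mul]
  exact endOrbit_subset_orbitClosure_holds (k := ℂ) (σ := τ) f ⟨P * A, rfl⟩

/-- The part of a form of degree `n` in the `ι`-variables is a form of degree `n`. [folklore] -/
theorem isHomogeneous_killCompl_linSubst (hι : Function.Injective ι) {f : MvPolynomial τ ℂ}
    {n : ℕ} (hf : f.IsHomogeneous n) (A : Matrix τ τ ℂ) :
    (killCompl hι (linSubst τ ℂ A f)).IsHomogeneous n := by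
  obtain ⟨P, hP⟩ := exists_rename_killCompl_eq_linSubst (ι := ι) hι
  rw [← IsHomogeneous.rename_isHomogeneous_iff hι, hP]
  exact linSubst_isHomogeneous P (linSubst_isHomogeneous A hf)

end Kill

/-! ### 2. The ray criterion for an arbitrary form -/

section General

variable {τ : Type} [Fintype τ] [LinearOrder τ] {N : ℕ}

/-- **Ray criterion, ⇐ (any placement).** Let `f` be a form of degree `n ≥ 1` on `τ ≃o Fin N`,
`κ : Fin j → τ` ANY injective placement of `j ≥ 1` letters, and `q` a `j`-variable form of
degree `n` with `κ(q) ∈ Δ(f)`. If `d ∈ E(q)` — some homogeneous `SL_j`-invariant of degree `d`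
does not vanish on `GL_j · q` (BI 2017 Def. 3.3) — then `j ∣ n d` and the rectangular weight
`((nd/j)^j)^*` OCCURS in `ℂ[Δ_n[f]]`: the invariant is a highest-weight vector of constant weight
`-(nd/j)·𝟙` for `Δ(q)` (`hasHighestWeight_const_of_mem_degreeMonoid`), inheritance carries it to
`Δ(κ q)` (BLMW Prop. 6.3.2, `hasHighestWeight_orbitCoordRep_rename_dualOfPartition_iff`), and
occurrence is monotone along `κ q ∈ Δ(f)` (`orbitMultiplicity_le_of_mem_orbitClosure`).
[cite: BurgisserIkenmeyer2017, Def. 3.3 and Rem. 3.13] -/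
theorem hasHighestWeight_rectangle_of_projection (e : Fin N ≃o τ) {f : MvPolynomial τ ℂ} {n : ℕ}
    (hn : n ≠ 0) (hf : f.IsHomogeneous n) {j : ℕ} (hj : 0 < j) (κ : Fin j → τ)
    (hκ : Function.Injective κ) {q : MvPolynomial (Fin j) ℂ} (hq : q.IsHomogeneous n)
    (hmem : rename κ q ∈ orbitClosure f) {d : ℕ} (hd : d ∈ degreeMonoid n q) :
    j ∣ n * d ∧ HasHighestWeight (orbitCoordRep f n)
      (fun x => Weight.dualOfPartition N (Nat.Partition.rectangle j (n * d / j)) (e.symm x)) := by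
  haveI : Infinite ℂ := CharZero.infinite ℂ
  obtain ⟨hdvd, hq'⟩ := hasHighestWeight_const_of_mem_degreeMonoid hj hq hd
  refine ⟨hdvd, ?_⟩
  have h1 : HasHighestWeight (orbitCoordRep q n)
      (Weight.dualOfPartition j (Nat.Partition.rectangle j (n * d / j))) := by
    rw [dualOfPartition_rectangle_self]
    exact hq'
  have h2 := (hasHighestWeight_orbitCoordRep_rename_dualOfPartition_iff e κ hκ q hn
    (Nat.Partition.rectangle j (n * d / j)) (card_parts_rectangle_le _ _)).mpr h1
  rw [← orbitMultiplicity_pos_iff_hasHighestWeight _ hn] at h2 ⊢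
  exact lt_of_lt_of_le h2
    (orbitMultiplicity_le_of_mem_orbitClosure_holds f (rename κ q) hn hf
      (IsHomogeneous.rename_isHomogeneous (f := κ) hq) hmem _)

/-- An `SL`-invariant that does not vanish AT `q` is not in the ideal of `GL · q`. [folklore] -/
theorem not_mem_orbitVanishingIdeal_of_aeval_ne_zero {j n : ℕ} {q : MvPolynomial (Fin j) ℂ}
    {F : MvPolynomial (DegIdx (Fin j) n) ℂ} (hF : aeval (formCoeff n q) F ≠ 0) :
    F ∉ orbitVanishingIdeal q n := by
  intro h
  rw [mem_orbitVanishingIdeal_iff] at h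
  have := h 1
  rw [linSubstRep_apply, Units.val_one, linSubst_one, AlgHom.id_apply] at this
  exact hF this

/-- **Ray criterion, ⇐, semistable form.** If some `j`-variable form `q` of degree `n` placed
injectively inside `Δ(f)` is `SL_j`-SEMISTABLE (`0 ∉ cl(SL_j · q)`), then the rectangular ray
`j` of `S(f)` is hit: `(k^j)^* ∈ S(f)` for some `k ≥ 1` (Mumford: semistable = some invariant of
positive degree does not vanish at `q`). [cite: MumfordFogartyKirwan1994, Ch. 2 §1 Prop. 2.2] -/
theorem exists_hasHighestWeight_rectangle_of_isSLSemistable_projection (e : Fin N ≃o τ)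
    {f : MvPolynomial τ ℂ} {n : ℕ} (hn : n ≠ 0) (hf : f.IsHomogeneous n) {j : ℕ} (hj : 0 < j)
    (κ : Fin j → τ) (hκ : Function.Injective κ) {q : MvPolynomial (Fin j) ℂ}
    (hq : q.IsHomogeneous n) (hmem : rename κ q ∈ orbitClosure f) (hss : IsSLSemistable q) :
    ∃ k : ℕ, 0 < k ∧ HasHighestWeight (orbitCoordRep f n)
      (fun x => Weight.dualOfPartition N (Nat.Partition.rectangle j k) (e.symm x)) := by
  obtain ⟨F, d, hd, hFd, hFi, hF⟩ := (isSLSemistable_iff_exists_isSLInvariantCoord hj hq).mp hss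
  have hdE : d ∈ degreeMonoid n q := ⟨F, hFd, hFi, not_mem_orbitVanishingIdeal_of_aeval_ne_zero hF⟩
  obtain ⟨hdvd, hocc⟩ := hasHighestWeight_rectangle_of_projection e hn hf hj κ hκ hq hmem hdE
  refine ⟨n * d / j, ?_, hocc⟩
  obtain ⟨c, hc⟩ := hdvd
  rw [hc, Nat.mul_div_cancel_left _ hj]
  rcases Nat.eq_zero_or_pos c with h0 | h0
  · exfalso
    rw [h0, mul_zero] at hc
    exact Nat.mul_ne_zero hn hd.ne' hc
  · exact h0

/-- **Ray criterion, ⇒.** Let `f` be a form of degree `n ≥ 1` on `τ ≃o Fin N` and suppose the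
rectangular weight `(k^j)^*` (`1 ≤ j ≤ N`, `k ≥ 1`) OCCURS in `ℂ[Δ_n[f]]`. Then there is a
`j`-variable degeneration `q` of `f` — explicitly: the part in the `j` greatest variables of a
translate `A · f`, `A ∈ GL_τ`, which placed on those variables lies in `Δ(f)` — and a degree
`d ≥ 1` with `j k = n d` and `d ∈ E(q)`: some homogeneous `SL_j`-invariant of degree `d` does not
vanish at `q`. Proof: a highest-weight vector `H ∉ I(GL·f)` of weight `(k^j)^*` is the renaming
of a highest-weight vector `H₀` of `ℂ[Sym^n ℂ^j]` of the constant weight `-k·𝟙` (inheritance,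
`highestWeightSpace_extend_eq_map`), an `SL_j`-invariant; `H(A·f) ≠ 0` for some `A`, and
`H(A·f) = H₀(q)` for the part `q` of `A·f` in the top variables. [cite: BurgisserEtAl2011, Prop. 6.3.2] -/
theorem exists_projection_of_hasHighestWeight_rectangle (e : Fin N ≃o τ) {f : MvPolynomial τ ℂ}
    {n : ℕ} (hn : n ≠ 0) (hf : f.IsHomogeneous n) {j : ℕ} (hj : 0 < j) (hjN : j ≤ N) {k : ℕ}
    (hk : 0 < k)
    (h : HasHighestWeight (orbitCoordRep f n)
      (fun x => Weight.dualOfPartition N (Nat.Partition.rectangle j k) (e.symm x))) :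
    ∃ q : MvPolynomial (Fin j) ℂ, q.IsHomogeneous n ∧
      rename (fun i => e (topEmb hjN i)) q ∈ orbitClosure f ∧
      (∃ A : GL τ ℂ,
        q = killCompl (strictMono_comp_topEmb e hjN).1.injective (linSubst τ ℂ (A : Matrix τ τ ℂ) f)) ∧
      ∃ d : ℕ, j * k = n * d ∧ 0 < d ∧ d ∈ degreeMonoid n q := by
  classical
  haveI : Infinite ℂ := CharZero.infinite ℂ
  have hι := strictMono_comp_topEmb e hjN
  have hχ := dualOfPartition_comp_symm_eq_extend e hjN (Nat.Partition.rectangle j k)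
    (card_parts_rectangle_le j k)
  obtain ⟨H, hH, hHI⟩ := exists_hwv_not_mem_of_occurs f n (show _ ≠ ⊥ from h)
  rw [hχ, highestWeightSpace_extend_eq_map hι.1 hι.2] at hH
  obtain ⟨H₀, hH₀, rfl⟩ := Submodule.mem_map.mp hH
  rw [dualOfPartition_rectangle_self] at hH₀
  rw [mem_orbitVanishingIdeal_iff] at hHI
  push Not at hHI
  obtain ⟨A, hA⟩ := hHI
  rw [AlgHom.toLinearMap_apply, linSubstRep_apply, aeval_formCoeff_rename_degIdxMap] at hA
  set q := killCompl hι.1.injective (linSubst τ ℂ (A : Matrix τ τ ℂ) f) with hqdef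
  have hq : q.IsHomogeneous n := isHomogeneous_killCompl_linSubst hι.1.injective hf _
  refine ⟨q, hq, rename_killCompl_linSubst_mem_orbitClosure hι.1.injective f _, ⟨A, rfl⟩, ?_⟩
  -- `H₀` is a nonzero highest-weight vector of constant weight `-k` for `Δ(q)`
  have hocc : HasHighestWeight (orbitCoordRep q n) (fun _ : Fin j => -(k : ℤ)) := by
    rw [hasHighestWeight_iff_exists]
    refine ⟨Ideal.Quotient.mk _ H₀, ?_, mk_mem_highestWeightSpace_orbitCoordRep q hH₀⟩
    rw [Ne, Ideal.Quotient.eq_zero_iff_mem]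
    exact not_mem_orbitVanishingIdeal_of_aeval_ne_zero hA
  exact exists_mem_degreeMonoid_of_hasHighestWeight_const hj hn q hk hocc

/-- **Ray criterion, ⇒, semistable form.** If `(k^j)^*` (`k ≥ 1`) occurs in `ℂ[Δ_n[f]]`, some
`j`-variable degeneration of `f` (a form of degree `n` on the `j` greatest variables inside
`Δ(f)`) is `SL_j`-semistable. [cite: MumfordFogartyKirwan1994, Ch. 2 §1 Prop. 2.2] -/
theorem exists_isSLSemistable_projection_of_hasHighestWeight_rectangle (e : Fin N ≃o τ)
    {f : MvPolynomial τ ℂ} {n : ℕ} (hn : n ≠ 0) (hf : f.IsHomogeneous n) {j : ℕ} (hj : 0 < j)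
    (hjN : j ≤ N) {k : ℕ} (hk : 0 < k)
    (h : HasHighestWeight (orbitCoordRep f n)
      (fun x => Weight.dualOfPartition N (Nat.Partition.rectangle j k) (e.symm x))) :
    ∃ q : MvPolynomial (Fin j) ℂ, q.IsHomogeneous n ∧
      rename (fun i => e (topEmb hjN i)) q ∈ orbitClosure f ∧ IsSLSemistable q := by
  obtain ⟨q, hq, hmem, -, d, -, hd, F, hFd, hFi, hFI⟩ :=
    exists_projection_of_hasHighestWeight_rectangle e hn hf hj hjN hk h
  refine ⟨q, hq, hmem, (isSLSemistable_iff_exists_isSLInvariantCoord hj hq).mpr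
    ⟨F, d, hd, hFd, hFi, aeval_formCoeff_ne_zero_of_not_mem hj hq hFd hFi hFI⟩⟩

end General

/-! ### 3. The permanent: rays of `S(per_m)` and the nullcone -/

section Permanent

variable {m : ℕ}

/-- The weight `λ^*` on the lexicographic matrix variables is `λ^*` of `GL_{m²}` read through
`matIdxEquiv m` (unfolding). [folklore] -/
theorem partitionWeightLex_eq_comp_symm {D : ℕ} (lam : Nat.Partition D) :
    partitionWeightLex m lam =
      fun x => Weight.dualOfPartition (m * m) lam ((matIdxEquiv m).symm x) :=
  rfl

/-- **Ray criterion for the permanent.** For `m ≥ 1`, `1 ≤ j ≤ m²`, `k ≥ 1`: the rectangular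
weight `(k^j)^*` occurs in `ℂ[Δ_m[per_m]]` iff some `j`-variable form `q` of degree `m`, placed
on the `j` greatest matrix variables inside `Δ(per_m)` (a `j`-variable degeneration of the
permanent), has `d ∈ E(q)` with `j k = m d`, `d ≥ 1` — an `SL_j`-invariant of degree `d = jk/m`
not vanishing at `q`. [cite: BurgisserIkenmeyer2017, Def. 3.3] -/
theorem per_hasHighestWeight_rectangle_iff (hm : 1 ≤ m) {j : ℕ} (hj : 0 < j) (hjm : j ≤ m * m)
    {k : ℕ} (hk : 0 < k) :
    highestWeightSpace (orbitCoordRep (MvPolynomial.rename toLex (perPoly (Fin m) ℂ)) m)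
        (partitionWeightLex m (Nat.Partition.rectangle j k)) ≠ ⊥ ↔
      ∃ q : MvPolynomial (Fin j) ℂ, q.IsHomogeneous m ∧
        rename (fun i => matIdxEquiv m (topEmb hjm i)) q ∈
          orbitClosure (MvPolynomial.rename toLex (perPoly (Fin m) ℂ)) ∧
        ∃ d : ℕ, j * k = m * d ∧ 0 < d ∧ d ∈ degreeMonoid m q := by
  have hm0 : m ≠ 0 := by omega
  constructor
  · intro h
    obtain ⟨q, hq, hmem, -, hd⟩ := exists_projection_of_hasHighestWeight_rectangle (matIdxEquiv m)
      hm0 (perFormLex_isHomogeneous m) hj hjm hk (show HasHighestWeight _ _ from h)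
    exact ⟨q, hq, hmem, hd⟩
  · rintro ⟨q, hq, hmem, d, hjk, hd, hdE⟩
    obtain ⟨-, hocc⟩ := hasHighestWeight_rectangle_of_projection (matIdxEquiv m) hm0
      (perFormLex_isHomogeneous m) hj _ (strictMono_comp_topEmb (matIdxEquiv m) hjm).1.injective
      hq hmem hdE
    have hk' : m * d / j = k := by
      rw [← hjk, Nat.mul_div_cancel_left _ hj]
    rw [hk'] at hocc
    exact hocc

/-- **The ray `j` of `S(per_m)` is hit iff the permanent has an `SL_j`-semistable `j`-variable
degeneration** (`m ≥ 1`, `1 ≤ j ≤ m²`). [cite: MumfordFogartyKirwan1994, Ch. 2 §1 Prop. 2.2] -/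
theorem per_ray_hit_iff_exists_isSLSemistable (hm : 1 ≤ m) {j : ℕ} (hj : 0 < j)
    (hjm : j ≤ m * m) :
    (∃ k : ℕ, 0 < k ∧
      highestWeightSpace (orbitCoordRep (MvPolynomial.rename toLex (perPoly (Fin m) ℂ)) m)
        (partitionWeightLex m (Nat.Partition.rectangle j k)) ≠ ⊥) ↔
      ∃ q : MvPolynomial (Fin j) ℂ, q.IsHomogeneous m ∧
        rename (fun i => matIdxEquiv m (topEmb hjm i)) q ∈
          orbitClosure (MvPolynomial.rename toLex (perPoly (Fin m) ℂ)) ∧ IsSLSemistable q := by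
  have hm0 : m ≠ 0 := by omega
  constructor
  · rintro ⟨k, hk, h⟩
    exact exists_isSLSemistable_projection_of_hasHighestWeight_rectangle (matIdxEquiv m) hm0
      (perFormLex_isHomogeneous m) hj hjm hk (show HasHighestWeight _ _ from h)
  · rintro ⟨q, hq, hmem, hss⟩
    exact exists_hasHighestWeight_rectangle_of_isSLSemistable_projection (matIdxEquiv m) hm0
      (perFormLex_isHomogeneous m) hj _ (strictMono_comp_topEmb (matIdxEquiv m) hjm).1.injective
      hq hmem hss

/-- **`stub_atomLate` from nullcone-inseparability in quasi-polynomial degree.** Suppose that for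
every `c, m₀` some `m ≥ max(m₀,1)` has a ray `j ∈ [1, m²]` such that (a) some `j`-variable
degeneration of `per_m` (a degree-`m` form on the `j` greatest matrix variables inside
`Δ(per_m)`) is `SL_j`-semistable, but (b) every positive element `d` of the degree monoid `E(q)`
of every `j`-variable degeneration `q` of `per_m` exceeds `2^((log₂ m + c)^c)` — no
`SL_j`-invariant of quasi-polynomial degree is nonzero at any `j`-variable degeneration of the
permanent. Then the registered `stub_atomLate` holds verbatim: the first weight on ray `j` is an
atom (`…RectangularRays`) and by the ray criterion its degree `jk/m` is such a `d`.
[cite: BurgisserIkenmeyer2017, Def. 3.3] -/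
theorem stub_atomLate_of_nullcone_inseparable
    (H : ∀ c m₀ : ℕ, ∃ m : ℕ, m₀ ≤ m ∧ 1 ≤ m ∧ ∃ j : ℕ, ∃ hj : 0 < j ∧ j ≤ m * m,
      (∃ q : MvPolynomial (Fin j) ℂ, q.IsHomogeneous m ∧
        rename (fun i => matIdxEquiv m (topEmb hj.2 i)) q ∈
          orbitClosure (MvPolynomial.rename toLex (perPoly (Fin m) ℂ)) ∧ IsSLSemistable q) ∧
      (∀ q : MvPolynomial (Fin j) ℂ, q.IsHomogeneous m →
        rename (fun i => matIdxEquiv m (topEmb hj.2 i)) q ∈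
          orbitClosure (MvPolynomial.rename toLex (perPoly (Fin m) ℂ)) →
        ∀ d ∈ degreeMonoid m q, 0 < d → 2 ^ ((Nat.log 2 m + c) ^ c) < d)) :
    ∀ c m₀ : ℕ, ∃ m : ℕ, m₀ ≤ m ∧ 1 ≤ m ∧ ∃ χ : Weight (MatIdx m),
      highestWeightSpace (orbitCoordRep (MvPolynomial.rename toLex (perPoly (Fin m) ℂ)) m) χ ≠ ⊥ ∧
      (∀ χ₁ χ₂ : Weight (MatIdx m), χ₁ + χ₂ = χ → χ₁ ≠ 0 → χ₂ ≠ 0 →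
          highestWeightSpace (orbitCoordRep (MvPolynomial.rename toLex (perPoly (Fin m) ℂ)) m) χ₁ = ⊥ ∨
            highestWeightSpace (orbitCoordRep (MvPolynomial.rename toLex (perPoly (Fin m) ℂ)) m) χ₂ = ⊥) ∧
      (m : ℤ) * 2 ^ ((Nat.log 2 m + c) ^ c) < -(Weight.size χ) := by
  apply stub_atomLate_of_late_rectangle
  intro c m₀
  obtain ⟨m, hm₀, hm, j, hj, hhit, hlate⟩ := H c m₀
  refine ⟨m, hm₀, hm, j, hj.1, hj.2, (per_ray_hit_iff_exists_isSLSemistable hm hj.1 hj.2).mpr hhit, ?_⟩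
  intro k hk hocc
  obtain ⟨q, hq, hmem, d, hjk, hd, hdE⟩ :=
    (per_hasHighestWeight_rectangle_iff hm hj.1 hj.2 hk).mp hocc
  have := hlate q hq hmem d hdE hd
  calc m * 2 ^ ((Nat.log 2 m + c) ^ c) < m * d := Nat.mul_lt_mul_of_pos_left this (by omega)
    _ = j * k := hjk.symm

end Permanent

end Summit.ValiantsHypothesis.ValiantsHypothesis.Theorems.GeneratorObstructions.PerGenDegreeSuperQP

end
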